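import Literature.MathematicalPhysics.KineticTheory.ReyBelletThomas2002Kernel
import Literature.MathematicalPhysics.KineticTheory.ConfinedDynkin
import HarnessLib

/-!
# Rey-Bellet–Thomas 2002: the transition semigroup of the heat-conduction chain (Dynkin, Feller)

Trunk T-KINETIC (Literature/MathematicalPhysics/KineticTheory). Inline decomposition step for the
named fact `ReyBelletThomas2002_thm21` (provefact unit): the transition kernels `rbKernel`
(`ReyBelletThomas2002Kernel.lean`) of the effective stochastic equations (RBT-SDE), RBT eq. (12),
ARE a `MarkovSemigroupFor (P.rbGenerator Λ N T_L T_R)` — the object `S` whose existence Theorem 2.1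
asserts first ("`T^t` the associated semigroup", "generator `L` given by Eq. (13)"):

* `OscillatorChain.rbRegularConfinedDrift` — under H1 (growth exponents `≥ 1`) and `γ ≥ 0` the drift
  `X₀` is a `RegularConfinedDrift` (`ConfinedFlowBounds.lean`): besides the confinement of
  `rbConfinedDrift`, the LOWER energy balance `DG·X₀(y + e) ≥ -((2|Λ| + γ)‖e‖ + 2γ)(G(y) + c)`
  (RBT Lemma 3.5: the dissipation `-γ r²` is at most `2γ(G + c)`) and the noise-shift bound
  `|G(y + e) - G(y)| ≤ 2‖e‖(G(y) + c)` for reservoir perturbations `‖e‖ ≤ 1`.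
* `OscillatorChain.rbGenerator_eq_sdeGenerator` — the generator `L` of RBT eq. (13) is
  `Df·X₀ + ½(D²f[v_L,v_L] + D²f[v_R,v_R])`, `v_b = √(2γT_b) ∂_{r_b}`, on `C²` functions.
* `OscillatorChain.rbKernel_dynkin` — Dynkin's identity `P_t f - f = ∫₀ᵗ P_s(Lf) ds` on `C²_c`
  (`ConfinedDynkin.lean`), and `OscillatorChain.rbSemigroup : MarkovSemigroupFor (P.rbGenerator …)`
  with `continuous_act_rbSemigroup` (Feller).

## References

* L. Rey-Bellet, L. E. Thomas, *Exponential convergence to non-equilibrium stationary states in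
  classical statistical mechanics*, Comm. Math. Phys. 225 (2002) 305–329, §2 eqs. (12)–(13),
  §3.1 and Lemma 3.5.
-/

noncomputable section

open MeasureTheory ProbabilityTheory Filter Set Finset
open scoped NNReal ENNReal

namespace Literature.MathematicalPhysics.KineticTheory.HeatConduction

open Literature.Probability.Process

variable {N : ℕ}

namespace OscillatorChain

variable (P : OscillatorChain)

/-! ### The energy under reservoir perturbations -/

/-- `G(y + (0,e)) - G(y) = r_L e_L + r_R e_R + (e_L² + e_R²)/2`. [folklore] -/
theorem rbEnergy_add_zero_prod (N : ℕ) (y : RBPhaseSpace N) (e : ℝ × ℝ) :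
    P.rbEnergy N (y + ((0 : PhaseSpace N), e)) - P.rbEnergy N y =
      y.2.1 * e.1 + y.2.2 * e.2 + (e.1 ^ 2 + e.2 ^ 2) / 2 := by
  unfold rbEnergy
  simp only [Prod.fst_add, Prod.snd_add, add_zero]
  ring

/-- The kinetic bookkeeping behind Lemma 3.5: with `K₀ = N m_U + N² m_V` (`U ≥ m_U`, `V ≥ m_V`,
`m_V ≤ 0`) and `c = N/2 + 1 - K₀`, one has `K₀ ≤ H(q,p)`, `H ≤ G`, `∑|p_i| ≤ G + c - 1`,
`|r_L| + |r_R| ≤ G + c - N/2` and `0 ≤ G + c - N/2 - 1`. [folklore] -/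
theorem rbEnergy_bookkeeping {m_U m_V : ℝ} (hmV : m_V ≤ 0) (hU : ∀ q, m_U ≤ P.U q)
    (hV : ∀ q, m_V ≤ P.V q) (N : ℕ) (y : RBPhaseSpace N) :
    (N * m_U + N ^ 2 * m_V ≤ P.hamiltonian N y.1) ∧
    (P.hamiltonian N y.1 ≤ P.rbEnergy N y) ∧
    (∑ i : Fin N, |y.1.2 i| ≤ P.rbEnergy N y + ((N : ℝ) / 2 + 1 - (N * m_U + N ^ 2 * m_V)) - 1) ∧
    (|y.2.1| + |y.2.2| ≤ P.rbEnergy N y + ((N : ℝ) / 2 + 1 - (N * m_U + N ^ 2 * m_V)) - N / 2) ∧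
    ((y.2.1 ^ 2 + y.2.2 ^ 2) / 2 ≤ P.rbEnergy N y - (N * m_U + N ^ 2 * m_V)) := by
  have hkin := P.kinetic_le_hamiltonian hmV hU hV N y.1
  have hG : P.rbEnergy N y = (y.2.1 ^ 2 + y.2.2 ^ 2) / 2 + P.hamiltonian N y.1 := rfl
  have h0 : 0 ≤ ∑ i : Fin N, y.1.2 i ^ 2 / 2 := Finset.sum_nonneg fun i _ => by positivity
  have hr2 : 0 ≤ (y.2.1 ^ 2 + y.2.2 ^ 2) / 2 := by positivity
  have hS : ∑ i : Fin N, |y.1.2 i| ≤ N / 2 + ∑ i : Fin N, y.1.2 i ^ 2 / 2 := by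
    calc ∑ i : Fin N, |y.1.2 i| ≤ ∑ i : Fin N, (1 / 2 + y.1.2 i ^ 2 / 2) :=
          Finset.sum_le_sum fun i _ => abs_le_half_add_sq_half (y.1.2 i)
      _ = N / 2 + ∑ i : Fin N, y.1.2 i ^ 2 / 2 := by
          rw [Finset.sum_add_distrib, Finset.sum_const, Finset.card_univ, Fintype.card_fin,
            nsmul_eq_mul]
          ring
  have hab : |y.2.1| + |y.2.2| ≤ 1 + (y.2.1 ^ 2 + y.2.2 ^ 2) / 2 := by
    have := abs_le_half_add_sq_half y.2.1
    have := abs_le_half_add_sq_half y.2.2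
    linarith
  refine ⟨by linarith, by linarith, by linarith, by linarith, by linarith⟩

/-- **The lower energy balance of Lemma 3.5**: for a differentiable Hamiltonian with potentials
bounded below (`U ≥ m_U`, `V ≥ m_V`, `m_V ≤ 0`), `γ ≥ 0`, any coupling `Λ`, any point `y` and any
reservoir perturbation `e = (0,(e_L,e_R))`:
`-(((2|Λ| + γ)‖e‖ + 2γ)(G(y) + c)) ≤ DG(y)·X₀(y + e)`, `c = N/2 + 1 - N m_U - N² m_V` — the energy
balance `DG·X₀(y+e) = -Λ(e_L p_1 + e_R p_n) - γ r² - γ r·e` with `γ r² = 2γ(G - H) ≤ 2γ(G + c)`.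
[cite: ReyBelletThomas2002, Lemma 3.5] -/
theorem fderiv_rbEnergy_rbDrift_ge (hH : Differentiable ℝ (P.hamiltonian N)) (hγ : 0 ≤ P.γ)
    {m_U m_V : ℝ} (hmV : m_V ≤ 0) (hU : ∀ q, m_U ≤ P.U q) (hV : ∀ q, m_V ≤ P.V q)
    (Λ : ℝ) (y : RBPhaseSpace N) (e : ℝ × ℝ) :
    -((((2 * |Λ| + P.γ) * ‖e‖ + 2 * P.γ)) *
        (P.rbEnergy N y + ((N : ℝ) / 2 + 1 - (N * m_U + N ^ 2 * m_V)))) ≤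
      fderiv ℝ (P.rbEnergy N) y (P.rbDrift Λ N (y + ((0 : PhaseSpace N), e))) := by
  rw [P.fderiv_rbEnergy_rbDrift hH]
  obtain ⟨hK, hHG, hS, hr, hr2⟩ := P.rbEnergy_bookkeeping hmV hU hV N y
  set A : ℝ := ∑ i : Fin N, if i.val = 0 then y.1.2 i else 0 with hA
  set B : ℝ := ∑ i : Fin N, if i.val = N - 1 then y.1.2 i else 0 with hB
  set S : ℝ := ∑ i : Fin N, |y.1.2 i| with hS'
  set Gc : ℝ := P.rbEnergy N y + ((N : ℝ) / 2 + 1 - (N * m_U + N ^ 2 * m_V)) with hGc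
  have hN0 : (0 : ℝ) ≤ N / 2 := by positivity
  have hGc0 : 0 ≤ Gc := by
    have : (0 : ℝ) ≤ |y.2.1| + |y.2.2| := by positivity
    linarith
  have hAS : |A| ≤ S := (Finset.abs_sum_le_sum_abs _ _).trans
    (Finset.sum_le_sum fun i _ => by split_ifs <;> simp)
  have hBS : |B| ≤ S := (Finset.abs_sum_le_sum_abs _ _).trans
    (Finset.sum_le_sum fun i _ => by split_ifs <;> simp)
  have he1 : |e.1| ≤ ‖e‖ := by simpa [Real.norm_eq_abs] using norm_fst_le e
  have he2 : |e.2| ≤ ‖e‖ := by simpa [Real.norm_eq_abs] using norm_snd_le e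
  have he0 : 0 ≤ ‖e‖ := norm_nonneg e
  -- term 1: `-Λ (e₁ A + e₂ B) ≥ -2|Λ| ‖e‖ Gc`
  have h1 : -(2 * |Λ| * ‖e‖ * Gc) ≤ -Λ * (e.1 * A + e.2 * B) := by
    have hx : |e.1 * A + e.2 * B| ≤ ‖e‖ * S + ‖e‖ * S := by
      refine (abs_add_le _ _).trans (add_le_add ?_ ?_)
      · rw [abs_mul]; exact mul_le_mul he1 hAS (abs_nonneg _) he0
      · rw [abs_mul]; exact mul_le_mul he2 hBS (abs_nonneg _) he0
    have hle : -(|Λ| * |e.1 * A + e.2 * B|) ≤ -Λ * (e.1 * A + e.2 * B) := by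
      rw [← abs_mul]
      have h5 := le_abs_self (Λ * (e.1 * A + e.2 * B))
      linarith
    have h3 : |Λ| * |e.1 * A + e.2 * B| ≤ |Λ| * (‖e‖ * S + ‖e‖ * S) :=
      mul_le_mul_of_nonneg_left hx (abs_nonneg Λ)
    have h4 : |Λ| * (‖e‖ * S + ‖e‖ * S) ≤ 2 * |Λ| * ‖e‖ * Gc := by
      have hSG : S ≤ Gc := by linarith
      have := mul_le_mul_of_nonneg_left hSG (by positivity : 0 ≤ 2 * |Λ| * ‖e‖)
      linarith [this]
    linarith
  -- term 2: `-γ r² ≥ -2γ Gc`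
  have h2 : -(2 * P.γ * Gc) ≤ -(P.γ * (y.2.1 ^ 2 + y.2.2 ^ 2)) := by
    have hrG : y.2.1 ^ 2 + y.2.2 ^ 2 ≤ 2 * Gc := by linarith
    nlinarith
  -- term 3: `-γ (r_L e₁ + r_R e₂) ≥ -γ ‖e‖ Gc`
  have h3 : -(P.γ * ‖e‖ * Gc) ≤ -(P.γ * (y.2.1 * e.1 + y.2.2 * e.2)) := by
    have hrE : |y.2.1 * e.1 + y.2.2 * e.2| ≤ ‖e‖ * (|y.2.1| + |y.2.2|) := by
      refine (abs_add_le _ _).trans ?_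
      rw [abs_mul, abs_mul, mul_add]
      exact add_le_add (by nlinarith [abs_nonneg y.2.1]) (by nlinarith [abs_nonneg y.2.2])
    have h4 : ‖e‖ * (|y.2.1| + |y.2.2|) ≤ ‖e‖ * Gc :=
      mul_le_mul_of_nonneg_left (by linarith) he0
    have h5 := le_abs_self (y.2.1 * e.1 + y.2.2 * e.2)
    nlinarith [mul_le_mul_of_nonneg_left (hrE.trans h4) hγ]
  have htot : -(2 * |Λ| * ‖e‖ * Gc) + -(2 * P.γ * Gc) + -(P.γ * ‖e‖ * Gc) ≤
      -Λ * (e.1 * A + e.2 * B) - P.γ * (y.2.1 ^ 2 + y.2.2 ^ 2) - P.γ * (y.2.1 * e.1 + y.2.2 * e.2) := by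
    linarith
  refine le_trans (le_of_eq ?_) htot
  ring

/-- **The noise-shift bound**: `|G(y + e) - G(y)| ≤ 2‖e‖(G(y) + c)` for reservoir perturbations
`e = (0,(e_L,e_R))` with `‖e‖ ≤ 1` (`G(y+e) - G(y) = r·e + |e|²/2`, `|r_L| + |r_R| ≤ G + c - N/2`).
[folklore] -/
theorem abs_rbEnergy_add_sub_le {m_U m_V : ℝ} (hmV : m_V ≤ 0) (hU : ∀ q, m_U ≤ P.U q)
    (hV : ∀ q, m_V ≤ P.V q) (y : RBPhaseSpace N) (e : ℝ × ℝ) (he : ‖e‖ ≤ 1) :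
    |P.rbEnergy N (y + ((0 : PhaseSpace N), e)) - P.rbEnergy N y| ≤
      2 * ‖e‖ * (P.rbEnergy N y + ((N : ℝ) / 2 + 1 - (N * m_U + N ^ 2 * m_V))) := by
  rw [P.rbEnergy_add_zero_prod]
  obtain ⟨hK, hHG, -, hr, hr2⟩ := P.rbEnergy_bookkeeping hmV hU hV N y
  set Gc : ℝ := P.rbEnergy N y + ((N : ℝ) / 2 + 1 - (N * m_U + N ^ 2 * m_V)) with hGc
  have hN0 : (0 : ℝ) ≤ N / 2 := by positivity
  have he1 : |e.1| ≤ ‖e‖ := by simpa [Real.norm_eq_abs] using norm_fst_le e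
  have he2 : |e.2| ≤ ‖e‖ := by simpa [Real.norm_eq_abs] using norm_snd_le e
  have he0 : 0 ≤ ‖e‖ := norm_nonneg e
  have hrE : |y.2.1 * e.1 + y.2.2 * e.2| ≤ ‖e‖ * (|y.2.1| + |y.2.2|) := by
    refine (abs_add_le _ _).trans ?_
    rw [abs_mul, abs_mul, mul_add]
    exact add_le_add (by nlinarith [abs_nonneg y.2.1]) (by nlinarith [abs_nonneg y.2.2])
  have hsq : |(e.1 ^ 2 + e.2 ^ 2) / 2| ≤ ‖e‖ * ‖e‖ := by
    rw [abs_of_nonneg (by positivity)]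
    have h1 : e.1 ^ 2 ≤ ‖e‖ ^ 2 := by
      have := sq_abs e.1; nlinarith [abs_nonneg e.1]
    have h2 : e.2 ^ 2 ≤ ‖e‖ ^ 2 := by
      have := sq_abs e.2; nlinarith [abs_nonneg e.2]
    nlinarith
  have h3 : ‖e‖ * (|y.2.1| + |y.2.2|) + ‖e‖ * ‖e‖ ≤ 2 * ‖e‖ * Gc := by
    have h4 : |y.2.1| + |y.2.2| + ‖e‖ ≤ 2 * Gc := by nlinarith
    have := mul_le_mul_of_nonneg_left h4 he0
    nlinarith
  calc |y.2.1 * e.1 + y.2.2 * e.2 + (e.1 ^ 2 + e.2 ^ 2) / 2|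
      ≤ |y.2.1 * e.1 + y.2.2 * e.2| + |(e.1 ^ 2 + e.2 ^ 2) / 2| := abs_add_le _ _
    _ ≤ ‖e‖ * (|y.2.1| + |y.2.2|) + ‖e‖ * ‖e‖ := add_le_add hrE hsq
    _ ≤ 2 * ‖e‖ * Gc := h3

/-! ### The drift of (RBT-SDE) is a regular confined drift -/

section Regular

variable {P} {k₁ k₂ : ℝ} (hU : RBGrowth P.U k₁) (hV : RBGrowth P.V k₂) (hk₁ : 1 ≤ k₁) (hk₂ : 1 ≤ k₂)
  (hγ : 0 ≤ P.γ) (Λ : ℝ) (N : ℕ)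

/-- The energy of `rbConfinedDrift` is `G`. [folklore] -/
@[simp] theorem rbConfinedDrift_V : (P.rbConfinedDrift hU hV hk₁ hk₂ hγ Λ N).V = P.rbEnergy N := rfl

/-- The noise subspace of `rbConfinedDrift` is the reservoir subspace. [folklore] -/
@[simp] theorem rbConfinedDrift_noise : (P.rbConfinedDrift hU hV hk₁ hk₂ hγ Λ N).noise = rbNoise N := rfl

/-- The rate of `rbConfinedDrift` is `K(M) = (2|Λ| + γ) M`. [folklore] -/
@[simp] theorem rbConfinedDrift_K (M : ℝ) :
    (P.rbConfinedDrift hU hV hk₁ hk₂ hγ Λ N).K M = (2 * |Λ| + P.γ) * M := rfl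

/-- The constant of `rbConfinedDrift` is `c = N/2 + 1 - N m_U - N² m_V` with the lower bounds
`m_U, m_V ≤ 0` of the potentials chosen in its definition. [folklore] -/
theorem rbConfinedDrift_c : (P.rbConfinedDrift hU hV hk₁ hk₂ hγ Λ N).c =
    (N : ℝ) / 2 + 1 - (N * min (Classical.choose (hU.exists_forall_le hk₁)) 0 +
      N ^ 2 * min (Classical.choose (hV.exists_forall_le hk₂)) 0) := rfl

variable (P) in
/-- **The drift `X₀` of (RBT-SDE) is a REGULAR confined drift** under H1 (growth exponents `≥ 1`)
and `γ ≥ 0`: `rbConfinedDrift` together with the lower energy balance of Lemma 3.5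
(`K'(M) = (2|Λ| + γ) M + 2γ`) and the noise-shift bound (`K_s = 2`). Consequently the one-step
generator estimate and Dynkin's identity of `ConfinedGeneratorStep.lean` / `ConfinedDynkin.lean`
apply to (RBT-SDE). [cite: ReyBelletThomas2002, §2 eq. (12) and Lemma 3.5] -/
def rbRegularConfinedDrift : RegularConfinedDrift (P.rbDrift Λ N) :=
  let m_U : ℝ := min (Classical.choose (hU.exists_forall_le hk₁)) 0
  let m_V : ℝ := min (Classical.choose (hV.exists_forall_le hk₂)) 0
  have hmV : m_V ≤ 0 := min_le_right _ _
  have hUb : ∀ q, m_U ≤ P.U q := fun q =>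
    (min_le_left _ _).trans (Classical.choose_spec (hU.exists_forall_le hk₁) q)
  have hVb : ∀ q, m_V ≤ P.V q := fun q =>
    (min_le_left _ _).trans (Classical.choose_spec (hV.exists_forall_le hk₂) q)
  have hH : Differentiable ℝ (P.hamiltonian N) :=
    (P.contDiff_hamiltonian hU.1 hV.1 N).differentiable (by simp)
  { P.rbConfinedDrift hU hV hk₁ hk₂ hγ Λ N with
    K' := fun M => (2 * |Λ| + P.γ) * M + 2 * P.γ
    Kshift := 2
    rate_mono := fun M M' hMM' => by
      show (2 * |Λ| + P.γ) * M ≤ (2 * |Λ| + P.γ) * M'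
      exact mul_le_mul_of_nonneg_left hMM' (by positivity)
    rate'_nonneg := fun M hM => by positivity
    rate'_mono := fun M M' hMM' => by
      have : (2 * |Λ| + P.γ) * M ≤ (2 * |Λ| + P.γ) * M' := mul_le_mul_of_nonneg_left hMM' (by positivity)
      linarith
    Kshift_nonneg := by norm_num
    fderiv_energy_ge := fun M y e he heM => by
      have he1 : e.1 = 0 := mem_rbNoise.1 he
      have he' : e = (((0 : PhaseSpace N), e.2) : RBPhaseSpace N) := by
        ext <;> simp [he1]
      show -(((2 * |Λ| + P.γ) * M + 2 * P.γ) * (P.rbEnergy N y + ((N : ℝ) / 2 + 1 - (N * m_U + N ^ 2 * m_V)))) ≤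
        fderiv ℝ (P.rbEnergy N) y (P.rbDrift Λ N (y + e))
      rw [he']
      refine le_trans ?_ (P.fderiv_rbEnergy_rbDrift_ge hH hγ hmV hUb hVb Λ y e.2)
      obtain ⟨hK, hHG, -, hr, -⟩ := P.rbEnergy_bookkeeping hmV hUb hVb N y
      have hG0 : 0 ≤ P.rbEnergy N y + ((N : ℝ) / 2 + 1 - (N * m_U + N ^ 2 * m_V)) := by
        have : (0 : ℝ) ≤ |y.2.1| + |y.2.2| := by positivity
        have hN : (0 : ℝ) ≤ N / 2 := by positivity
        linarith
      have he2 : ‖e.2‖ ≤ M := (norm_snd_le e).trans heM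
      have hc : 0 ≤ 2 * |Λ| + P.γ := by positivity
      have hcoef : (2 * |Λ| + P.γ) * ‖e.2‖ + 2 * P.γ ≤ (2 * |Λ| + P.γ) * M + 2 * P.γ := by
        have := mul_le_mul_of_nonneg_left he2 hc; linarith
      exact neg_le_neg (mul_le_mul_of_nonneg_right hcoef hG0)
    energy_shift_le := fun y e he he1 => by
      have he10 : e.1 = 0 := mem_rbNoise.1 he
      have he' : e = (((0 : PhaseSpace N), e.2) : RBPhaseSpace N) := by
        ext <;> simp [he10]
      show |P.rbEnergy N (y + e) - P.rbEnergy N y| ≤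
        2 * ‖e‖ * (P.rbEnergy N y + ((N : ℝ) / 2 + 1 - (N * m_U + N ^ 2 * m_V)))
      have hn : ‖e.2‖ ≤ ‖e‖ := norm_snd_le e
      have hG0 : 0 ≤ P.rbEnergy N y + ((N : ℝ) / 2 + 1 - (N * m_U + N ^ 2 * m_V)) := by
        obtain ⟨hK, hHG, -, hr, -⟩ := P.rbEnergy_bookkeeping hmV hUb hVb N y
        have : (0 : ℝ) ≤ |y.2.1| + |y.2.2| := by positivity
        have hN : (0 : ℝ) ≤ N / 2 := by positivity
        linarith
      have h := P.abs_rbEnergy_add_sub_le hmV hUb hVb y e.2 (hn.trans he1)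
      rw [← he'] at h
      refine h.trans ?_
      exact mul_le_mul_of_nonneg_right (mul_le_mul_of_nonneg_left hn (by norm_num)) hG0 }

/-- The confined drift underlying `rbRegularConfinedDrift` is `rbConfinedDrift`. [folklore] -/
@[simp] theorem rbRegularConfinedDrift_toConfinedDrift :
    (P.rbRegularConfinedDrift hU hV hk₁ hk₂ hγ Λ N).toConfinedDrift = P.rbConfinedDrift hU hV hk₁ hk₂ hγ Λ N :=
  rfl

end Regular

/-! ### The generator of RBT eq. (13) as `Df·X₀ + ½ ∑_b D²f[v_b, v_b]` -/

/-- `∂_{r}∂_{r} f = D²f[e_r, e_r]` along a constant direction, for `f ∈ C²`. [folklore] -/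
theorem lineDeriv_lineDeriv_eq_fderiv_fderiv {f : RBPhaseSpace N → ℝ} (hf : ContDiff ℝ 2 f)
    (u : RBPhaseSpace N) (x : RBPhaseSpace N) :
    lineDeriv ℝ (fun y => lineDeriv ℝ f y u) x u = fderiv ℝ (fderiv ℝ f) x u u := by
  have hfd : Differentiable ℝ f := hf.differentiable (by norm_num)
  have hd : Differentiable ℝ (fderiv ℝ f) := (hf.fderiv_right (m := 1) (by norm_num)).differentiable one_ne_zero
  have h1 : (fun y => lineDeriv ℝ f y u) = fun y => fderiv ℝ f y u := funext fun y => (hfd y).lineDeriv_eq_fderiv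
  have hgd : Differentiable ℝ fun y => fderiv ℝ f y u := hd.clm_apply (differentiable_const u)
  rw [h1, (hgd x).lineDeriv_eq_fderiv, fderiv_clm_apply (hd x) (differentiableAt_const u)]
  simp

/-- **The generator `L` of RBT eq. (13) is the generator of (RBT-SDE)**: for `γT_L, γT_R ≥ 0` and
`f ∈ C²`, `L f = Df·X₀ + ½ (D²f[v_L, v_L] + D²f[v_R, v_R])` with `X₀ = rbDrift` and the noise vectors
`v_b = √(2γT_b) ∂_{r_b}` (`rbNoiseVec`), i.e. `L = sdeGenerator X₀ v_L v_R` on `C²`.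
[cite: ReyBelletThomas2002, §2 eq. (13)] -/
theorem rbGenerator_eq_sdeGenerator (Λ : ℝ) {T_L T_R : ℝ} (hL : 0 ≤ P.γ * T_L) (hR : 0 ≤ P.γ * T_R)
    {f : RBPhaseSpace N → ℝ} (hf : ContDiff ℝ 2 f) (x : RBPhaseSpace N) :
    P.rbGenerator Λ N T_L T_R f x =
      sdeGenerator (P.rbDrift Λ N) (P.rbNoiseVec N T_L T_R 0) (P.rbNoiseVec N T_L T_R 1) f x := by
  have hfd : Differentiable ℝ f := hf.differentiable (by norm_num)
  -- coordinate derivatives as Fréchet derivatives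
  have hQ : ∀ i, rbPartialQ i f x = fderiv ℝ f x (rbUnitQ i) := fun i => by
    simp only [rbPartialQ_eq_lineDeriv, rbUnitQ_eq]
    exact (hfd x).lineDeriv_eq_fderiv
  have hP : ∀ i, rbPartialP i f x = fderiv ℝ f x (rbUnitP i) := fun i => by
    simp only [rbPartialP_eq_lineDeriv, rbUnitP_eq]
    exact (hfd x).lineDeriv_eq_fderiv
  have hL' : partialRL f x = fderiv ℝ f x rbUnitRL := by
    simp only [partialRL_eq_lineDeriv, rbUnitRL_eq]
    exact (hfd x).lineDeriv_eq_fderiv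
  have hR' : partialRR f x = fderiv ℝ f x rbUnitRR := by
    simp only [partialRR_eq_lineDeriv, rbUnitRR_eq]
    exact (hfd x).lineDeriv_eq_fderiv
  have hLL : partialRL (partialRL f) x = fderiv ℝ (fderiv ℝ f) x rbUnitRL rbUnitRL := by
    simp only [partialRL_eq_lineDeriv]
    exact lineDeriv_lineDeriv_eq_fderiv_fderiv hf _ x
  have hRR : partialRR (partialRR f) x = fderiv ℝ (fderiv ℝ f) x rbUnitRR rbUnitRR := by
    simp only [partialRR_eq_lineDeriv]
    exact lineDeriv_lineDeriv_eq_fderiv_fderiv hf _ x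
  -- the second-order part
  have h2L : fderiv ℝ (fderiv ℝ f) x (P.rbNoiseVec N T_L T_R 0) (P.rbNoiseVec N T_L T_R 0) =
      2 * P.γ * T_L * fderiv ℝ (fderiv ℝ f) x rbUnitRL rbUnitRL := by
    simp only [rbNoiseVec, Matrix.cons_val_zero, map_smul, FunLike.coe_smul, Pi.smul_apply, smul_eq_mul]
    rw [← mul_assoc, Real.mul_self_sqrt (by linarith)]
  have h2R : fderiv ℝ (fderiv ℝ f) x (P.rbNoiseVec N T_L T_R 1) (P.rbNoiseVec N T_L T_R 1) =
      2 * P.γ * T_R * fderiv ℝ (fderiv ℝ f) x rbUnitRR rbUnitRR := by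
    simp only [rbNoiseVec, Matrix.cons_val_one, Matrix.cons_val_zero, map_smul, FunLike.coe_smul,
      Pi.smul_apply, smul_eq_mul]
    rw [← mul_assoc, Real.mul_self_sqrt (by linarith)]
  rw [sdeGenerator, h2L, h2R, P.fderiv_apply_rbDrift, rbGenerator]
  simp only [hQ, hP, hL', hR', hLL, hRR]
  -- per-site bookkeeping
  have key : ∀ i : Fin N,
      x.1.2 i * fderiv ℝ f x (rbUnitQ i) -
          partialQ i (P.hamiltonian N) x.1 * fderiv ℝ f x (rbUnitP i) +
        Λ * ((if i.val = 0 then x.1.2 i * fderiv ℝ f x rbUnitRL - x.2.1 * fderiv ℝ f x (rbUnitP i)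
              else 0) +
            (if i.val = N - 1 then
              x.1.2 i * fderiv ℝ f x rbUnitRR - x.2.2 * fderiv ℝ f x (rbUnitP i) else 0)) =
      x.1.2 i * fderiv ℝ f x (rbUnitQ i) +
        (-partialQ i (P.hamiltonian N) x.1 -
            Λ * ((if i.val = 0 then x.2.1 else 0) + (if i.val = N - 1 then x.2.2 else 0))) *
          fderiv ℝ f x (rbUnitP i) +
        Λ * (if i.val = 0 then x.1.2 i else 0) * fderiv ℝ f x rbUnitRL +
        Λ * (if i.val = N - 1 then x.1.2 i else 0) * fderiv ℝ f x rbUnitRR := fun i => by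
    split_ifs <;> ring
  rw [← Finset.sum_congr rfl fun i _ => key i]
  simp only [Finset.sum_add_distrib, Finset.sum_sub_distrib, Finset.mul_sum, mul_add]
  ring

/-! ### Dynkin's identity and the transition semigroup -/

section Semigroup

variable {P} {k₁ k₂ : ℝ} (hU : RBGrowth P.U k₁) (hV : RBGrowth P.V k₂) (hk₁ : 1 ≤ k₁) (hk₂ : 1 ≤ k₂)
  (hγ : 0 ≤ P.γ) (Λ : ℝ) (N : ℕ) {T_L T_R : ℝ} (hL : 0 ≤ T_L) (hR : 0 ≤ T_R)
include hU hV hk₁ hk₂ hγ hL hR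

/-- **Dynkin's identity for (RBT-SDE)**: `P_t f(z) - f(z) = ∫₀ᵗ P_s(Lf)(z) ds` for `f ∈ C²_c`,
`L = rbGenerator` the generator of RBT eq. (13) ("generator `L` given by Eq. (13)").
[cite: ReyBelletThomas2002, §2 eq. (13)] -/
theorem rbKernel_dynkin {f : RBPhaseSpace N → ℝ} (hf : ContDiff ℝ 2 f) (hf' : HasCompactSupport f)
    (t : ℝ≥0) (z : RBPhaseSpace N) :
    ∫ y, f y ∂(P.rbKernel Λ N T_L T_R t z) - f z =
      ∫ s in (0 : ℝ)..(t : ℝ), ∫ y, P.rbGenerator Λ N T_L T_R f y ∂(P.rbKernel Λ N T_L T_R s.toNNReal z) := by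
  have h := (P.rbRegularConfinedDrift hU hV hk₁ hk₂ hγ Λ N).sdeKernel_dynkin
    (v₁ := P.rbNoiseVec N T_L T_R 0) (v₂ := P.rbNoiseVec N T_L T_R 1)
    (P.rbNoiseVec_mem N T_L T_R 0) (P.rbNoiseVec_mem N T_L T_R 1) hf hf' t z
  have hgen : P.rbGenerator Λ N T_L T_R f =
      sdeGenerator (P.rbDrift Λ N) (P.rbNoiseVec N T_L T_R 0) (P.rbNoiseVec N T_L T_R 1) f :=
    funext fun x => P.rbGenerator_eq_sdeGenerator Λ (mul_nonneg hγ hL) (mul_nonneg hγ hR) hf x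
  rw [hgen]
  exact h

variable (P T_L T_R) in
/-- **The transition semigroup of (RBT-SDE)** under H1 (growth exponents `≥ 1`), `γ ≥ 0`,
`T_L, T_R ≥ 0`: the transition kernels `rbKernel` ARE a `MarkovSemigroupFor (P.rbGenerator Λ N T_L T_R)`
— Markov kernels, `P_0 = id`, Chapman–Kolmogorov, jointly measurable, Dynkin's identity on `C_c^∞`.
This is the object `T^t` of RBT Theorem 2.1 ("`T^t` the associated semigroup").
[cite: ReyBelletThomas2002, §2 eqs. (12)–(13) and Thm 2.1] -/
def rbSemigroup : MarkovSemigroupFor (P.rbGenerator Λ N T_L T_R) where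
  kernel := P.rbKernel Λ N T_L T_R
  isMarkovKernel := isMarkovKernel_rbKernel hU hV hk₁ hk₂ hγ Λ N T_L T_R
  kernel_zero := rbKernel_zero hU hV hk₁ hk₂ hγ Λ N T_L T_R
  kernel_add := rbKernel_add hU hV hk₁ hk₂ hγ Λ N T_L T_R
  measurable_kernel := measurable_rbKernel hU hV hk₁ hk₂ hγ Λ N T_L T_R
  dynkin := fun _ hf hf' t z => rbKernel_dynkin hU hV hk₁ hk₂ hγ Λ N hL hR (hf.of_le (by norm_cast)) hf' t z

/-- The kernels of `rbSemigroup` are the transition kernels `rbKernel`. [folklore] -/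
@[simp] theorem rbSemigroup_kernel (t : ℝ≥0) :
    (P.rbSemigroup hU hV hk₁ hk₂ hγ Λ N T_L T_R hL hR).kernel t = P.rbKernel Λ N T_L T_R t := rfl

/-- **The Feller property of the transition semigroup of (RBT-SDE)**: `P^t g` is continuous for
bounded continuous `g`. [cite: ReyBelletThomas2002, §4] -/
theorem continuous_act_rbSemigroup (t : ℝ≥0) (g : BoundedContinuousFunction (RBPhaseSpace N) ℝ) :
    Continuous ((P.rbSemigroup hU hV hk₁ hk₂ hγ Λ N T_L T_R hL hR).act t g) := by
  have h : (P.rbSemigroup hU hV hk₁ hk₂ hγ Λ N T_L T_R hL hR).act t g =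
      fun x => ∫ y, g y ∂(P.rbKernel Λ N T_L T_R t x) := rfl
  rw [h]
  exact continuous_integral_rbKernel_bcf hU hV hk₁ hk₂ hγ Λ N T_L T_R t g

/-- `P^t g(x) = E g(Φ_t(x, B))` for the semigroup action on a continuous `g`. [folklore] -/
theorem rbSemigroup_act_eq_integral (t : ℝ≥0) {g : RBPhaseSpace N → ℝ} (hg : Continuous g)
    (x : RBPhaseSpace N) :
    (P.rbSemigroup hU hV hk₁ hk₂ hγ Λ N T_L T_R hL hR).act t g x =
      ∫ ω, g (P.rbSolMap Λ N T_L T_R t x (pairPath ω)) ∂wienerPair :=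
  integral_rbKernel hU hV hk₁ hk₂ hγ Λ N T_L T_R t x hg.aestronglyMeasurable

end Semigroup

end OscillatorChain

end Literature.MathematicalPhysics.KineticTheory.HeatConduction
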